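import Summits.AtomisticToContinuum.BoseEinsteinCondensation.Theorems.BECHusimiAmplitudeGasHusimiConcentrationForm
import Summits.AtomisticToContinuum.BoseEinsteinCondensation.Theorems.BECHusimiAmplitudeGasHusimiConcentrationGaussian

/-!
# Husimi concentration, III: the pure-condensate coefficient is dominated by the Husimi mass

Part of the proof, for route `BECHusimiAmplitudeGas` of `AtomisticToContinuum/BoseEinsteinCondensation`,
that the Laplace-principle node `HusimiConcentration` (item stmt-AtomisticToContinuum-11994) follows
from the two cap estimates `PhaseCapDecay` (stmt-11990) and `AmplitudeLDP` (stmt-11991) — the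
content of the glue item `LaplaceCapUnion` (stmt-11995). Setting (generic over a finite index type
`ι` of modes with an injective labelling `m : ι → ℤ³`, `m i₀ = 0`): scaled plane waves
`e_i = e_{m i}/√L³` on the cell `[0,L)³`, `u_c = ∑ᵢ cᵢ eᵢ` for `c : ι → ℂ`, the degree-`N` form
`F(g) = ∫_{cell^N} ∏ⱼ conj g(xⱼ) Ψ(X) dX`, the Gaussian weight `w(c) = e^{-∑|cᵢ|²}` on
`ι → ℂ ≅ ℝ^{2|ι|}` (Lebesgue measure), and the word integrals
`J_k = ∫_{cell^N} ∏ⱼ conj e_{kⱼ}(xⱼ) Ψ` for words `k : Fin N → ι`.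

This file: **`coefficient_le`** — `|J_{k₀}|² ∫ w |c_{i₀}|^{2N} dc ≤ ∫ w |F(u_c)|² dc`, i.e. the
`|conj(c_{i₀})ᴺ|²`-term of the antiholomorphic polynomial `c ↦ F(u_c)` is bounded by the full
Gaussian `L²`-mass (Bargmann orthogonality of monomials). Instead of the full orthogonality we use a
*discrete phase average* in the single coordinate `i₀`: with `ω = e^{2πi/(N+1)}` and the rotations
`R_s c = (…, ωˢ c_{i₀}, …)`, `∑_{s=0}^{N} ω^{sN} F(u_{R_s c}) = (N+1) conj(c_{i₀})ᴺ J_{k₀}`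
(`sum_root_mul_form_rotate`, from the word expansion and the root-of-unity sums
`sum_pow_mul_conj_pow`), whence by Cauchy–Schwarz
`(N+1)|c_{i₀}|^{2N}|J_{k₀}|² ≤ ∑ₛ |F(u_{R_s c})|²` pointwise, and each rotated integral equals the
unrotated one (`measurePreserving_rotate_coord`). All [folklore].
-/

noncomputable section

namespace Summit.AtomisticToContinuum.BoseEinsteinCondensation.Theorems

open MeasureTheory
open scoped ENNReal NNReal ComplexConjugate BigOperators
open Literature.MathematicalPhysics.QuantumManyBody.BoseGas
open Literature.Probability.RandomMatrix

namespace HusimiConcentration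

variable {ι : Type*} [Fintype ι] {N : ℕ} {L : ℝ}


/-- Algebraic core of the discrete phase average. For a primitive `(N+1)`-st root of unity
`ω` and `n ≤ N`: `∑_{s=0}^{N} ω^{sN} conj(ω^s)^n = (N+1)·[n = N]`. [folklore] -/
theorem sum_pow_mul_conj_pow {ω : ℂ} (hω : IsPrimitiveRoot ω (N + 1)) {n : ℕ} (hn : n ≤ N) :
    ∑ s ∈ Finset.range (N + 1), ω ^ (s * N) * conj (ω ^ s) ^ n =
      if n = N then (N + 1 : ℂ) else 0 := by
  have hω1 : ‖ω‖ = 1 := hω.norm'_eq_one (Nat.succ_ne_zero N)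
  have hω0 : ω ≠ 0 := fun h => by simp [h] at hω1
  have hconj : conj ω = ω⁻¹ := (Complex.inv_eq_conj hω1).symm
  -- rewrite the summand as `(ω^{N-n})^s`
  have hterm : ∀ s : ℕ, ω ^ (s * N) * conj (ω ^ s) ^ n = (ω ^ (N - n)) ^ s := by
    intro s
    have hsplit : s * N = (N - n) * s + n * s := by
      rw [← Nat.add_mul, Nat.sub_add_cancel hn, mul_comm]
    rw [map_pow, hconj, ← pow_mul, ← pow_mul, hsplit, pow_add, inv_pow, mul_comm s n, mul_assoc,
      mul_inv_cancel₀ (pow_ne_zero _ hω0), mul_one]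
  simp_rw [hterm]
  by_cases h : n = N
  · subst h
    simp
  · rw [if_neg h]
    have hlt : N - n < N + 1 := by omega
    have hpos : 0 < N - n := by omega
    have hne : ω ^ (N - n) ≠ 1 := by
      rw [Ne, hω.pow_eq_one_iff_dvd]
      exact Nat.not_dvd_of_pos_of_lt hpos hlt
    have hpow : (ω ^ (N - n)) ^ (N + 1) = 1 := by
      rw [← pow_mul, mul_comm, pow_mul, hω.pow_eq_one, one_pow]
    have := geom_sum_mul (ω ^ (N - n)) (N + 1)
    rw [hpow, sub_self, mul_eq_zero] at this
    exact this.resolve_right (sub_ne_zero.2 hne)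


/-- **Discrete phase average isolates the pure-condensate coefficient**: for a primitive
`(N+1)`-st root of unity `ω` and the rotations `R_s c = (…, ω^s c_{i₀}, …)`,
`∑_{s=0}^{N} ω^{sN} F(u_{R_s c}) = (N+1) conj(c_{i₀})^N J_{k₀}`. [folklore] -/
theorem sum_root_mul_form_rotate [DecidableEq ι] (m : ι → (Fin 3 → ℤ)) {Ψ : Config N → ℂ}
    (hΨ : Continuous Ψ) (i₀ : ι) {ω : ℂ} (hω : IsPrimitiveRoot ω (N + 1)) (c : ι → ℂ) :
    ∑ s ∈ Finset.range (N + 1), ω ^ (s * N) *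
      ∫ X in cellN N L, (∏ j, conj (∑ i, (fun i => if i = i₀ then ω ^ s * c i else c i) i *
        (cellWave L (m i) (X j) / (Real.sqrt (L ^ 3) : ℂ)))) * Ψ X =
    (N + 1 : ℂ) * conj (c i₀) ^ N *
      ∫ X in cellN N L, (∏ j : Fin N, conj (cellWave L (m i₀) (X j) / (Real.sqrt (L ^ 3) : ℂ))) *
        Ψ X := by
  have hrot : ∀ s : ℕ, ω ^ (s * N) *
      (∫ X in cellN N L, (∏ j, conj (∑ i, (fun i => if i = i₀ then ω ^ s * c i else c i) i *
        (cellWave L (m i) (X j) / (Real.sqrt (L ^ 3) : ℂ)))) * Ψ X) =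
      ∑ k : Fin N → ι, (ω ^ (s * N) * conj (ω ^ s) ^ (Finset.univ.filter fun j => k j = i₀).card) *
        (conj (∏ j, c (k j)) *
          ∫ X in cellN N L, (∏ j, conj (cellWave L (m (k j)) (X j) / (Real.sqrt (L ^ 3) : ℂ))) *
            Ψ X) := by
    intro s
    rw [form_rotate m hΨ i₀ (ω ^ s) c, Finset.mul_sum]
    refine Finset.sum_congr rfl fun k _ => ?_
    ring
  simp_rw [hrot]
  rw [Finset.sum_comm]
  have hn : ∀ k : Fin N → ι, (Finset.univ.filter fun j => k j = i₀).card ≤ N := fun k =>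
    (Finset.card_filter_le _ _).trans (by rw [Finset.card_univ, Fintype.card_fin])
  have hinner : ∀ k : Fin N → ι,
      ∑ s ∈ Finset.range (N + 1), (ω ^ (s * N) * conj (ω ^ s) ^ (Finset.univ.filter fun j => k j = i₀).card) *
        (conj (∏ j, c (k j)) *
          ∫ X in cellN N L, (∏ j, conj (cellWave L (m (k j)) (X j) / (Real.sqrt (L ^ 3) : ℂ))) *
            Ψ X) =
      (if (Finset.univ.filter fun j => k j = i₀).card = N then (N + 1 : ℂ) else 0) *
        (conj (∏ j, c (k j)) *
          ∫ X in cellN N L, (∏ j, conj (cellWave L (m (k j)) (X j) / (Real.sqrt (L ^ 3) : ℂ))) *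
            Ψ X) := by
    intro k
    rw [← Finset.sum_mul, sum_pow_mul_conj_pow hω (hn k)]
  rw [Finset.sum_congr rfl fun k _ => hinner k, Finset.sum_eq_single (fun _ : Fin N => i₀)]
  · have hcard : (Finset.univ.filter fun j : Fin N => (fun _ : Fin N => i₀) j = i₀).card = N := by
      simp
    rw [if_pos hcard, Finset.prod_const, Finset.card_univ, Fintype.card_fin, map_pow, mul_assoc]
  · intro k _ hk
    have hex : ∃ j, k j ≠ i₀ := by
      by_contra h
      push Not at h
      exact hk (funext h)
    obtain ⟨j, hj⟩ := hex
    have hlt : (Finset.univ.filter fun j => k j = i₀).card < N := by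
      calc (Finset.univ.filter fun j => k j = i₀).card < (Finset.univ : Finset (Fin N)).card :=
            Finset.card_lt_card (Finset.filter_ssubset.2 ⟨j, Finset.mem_univ j, hj⟩)
        _ = N := by rw [Finset.card_univ, Fintype.card_fin]
    rw [if_neg hlt.ne, zero_mul]
  · intro h; exact absurd (Finset.mem_univ _) h

/-- The Gaussian weight times the squared Husimi form is measurable in the coefficients.
[folklore] -/
theorem measurable_weight_mul_form (m : ι → (Fin 3 → ℤ)) {Ψ : Config N → ℂ} (hΨ : Continuous Ψ) :
    Measurable fun c : ι → ℂ => ENNReal.ofReal (Real.exp (-∑ i, ‖c i‖ ^ 2)) *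
      ((‖∫ X in cellN N L, (∏ j, conj (∑ i, c i *
        (cellWave L (m i) (X j) / (Real.sqrt (L ^ 3) : ℂ)))) * Ψ X‖₊ : ℝ≥0∞) ^ 2) := by
  refine Measurable.mul ?_ ((continuous_form m hΨ).measurable.nnnorm.coe_nnreal_ennreal.pow_const _)
  exact ENNReal.measurable_ofReal.comp (Real.measurable_exp.comp measurable_nsq.neg)

/-- **The pure-condensate coefficient is dominated by the full Husimi mass** (Bargmann
orthogonality of the antiholomorphic monomials, here through a discrete phase average in the
coordinate `i₀` and Cauchy–Schwarz):
`|J_{k₀}|² ∫ e^{-|c|²} |c_{i₀}|^{2N} dc ≤ ∫ e^{-|c|²} |F(u_c)|² dc`. [folklore] -/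
theorem coefficient_le [DecidableEq ι] (m : ι → (Fin 3 → ℤ)) {Ψ : Config N → ℂ} (hΨ : Continuous Ψ)
    (i₀ : ι) :
    ((‖∫ X in cellN N L, (∏ j : Fin N, conj (cellWave L (m i₀) (X j) / (Real.sqrt (L ^ 3) : ℂ))) *
        Ψ X‖₊ : ℝ≥0∞) ^ 2) *
      ∫⁻ c : ι → ℂ, ENNReal.ofReal (Real.exp (-∑ i, ‖c i‖ ^ 2)) * (‖c i₀‖₊ : ℝ≥0∞) ^ (2 * N) ≤
    ∫⁻ c : ι → ℂ, ENNReal.ofReal (Real.exp (-∑ i, ‖c i‖ ^ 2)) *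
      ((‖∫ X in cellN N L, (∏ j, conj (∑ i, c i *
        (cellWave L (m i) (X j) / (Real.sqrt (L ^ 3) : ℂ)))) * Ψ X‖₊ : ℝ≥0∞) ^ 2) := by
  -- notation
  set J₀ : ℂ := ∫ X in cellN N L, (∏ j : Fin N, conj (cellWave L (m i₀) (X j) /
    (Real.sqrt (L ^ 3) : ℂ))) * Ψ X with hJ₀
  set Fu : (ι → ℂ) → ℂ := fun c => ∫ X in cellN N L, (∏ j, conj (∑ i, c i *
    (cellWave L (m i) (X j) / (Real.sqrt (L ^ 3) : ℂ)))) * Ψ X with hFu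
  set w : (ι → ℂ) → ℝ≥0∞ := fun c => ENNReal.ofReal (Real.exp (-∑ i, ‖c i‖ ^ 2)) with hw
  -- the root of unity and the rotations
  set ωc : Circle := Circle.exp (2 * Real.pi / (N + 1)) with hωc
  have hω : IsPrimitiveRoot (ωc : ℂ) (N + 1) := by
    have h1 : (ωc : ℂ) = Complex.exp (2 * Real.pi * Complex.I / ((N + 1 : ℕ) : ℂ)) := by
      rw [hωc, Circle.coe_exp]
      congr 1
      push_cast
      ring
    rw [h1]
    exact Complex.isPrimitiveRoot_exp _ (Nat.succ_ne_zero N)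
  set R : ℕ → (ι → ℂ) → (ι → ℂ) := fun s c i => if i = i₀ then ((ωc ^ s : Circle) : ℂ) * c i else c i
    with hR
  -- pointwise: `(N+1) |J₀|² |c_{i₀}|^{2N} ≤ ∑ₛ |F(u_{R_s c})|²`
  have hpt : ∀ c : ι → ℂ, ((N + 1 : ℕ) : ℝ≥0∞) * (((‖J₀‖₊ : ℝ≥0∞) ^ 2) * (‖c i₀‖₊ : ℝ≥0∞) ^ (2 * N)) ≤
      ∑ s ∈ Finset.range (N + 1), ((‖Fu (R s c)‖₊ : ℝ≥0∞) ^ 2) := by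
    intro c
    have hid := sum_root_mul_form_rotate (L := L) m hΨ i₀ hω c
    have hid' : ∑ s ∈ Finset.range (N + 1), (ωc : ℂ) ^ (s * N) * Fu (R s c) =
        (N + 1 : ℂ) * conj (c i₀) ^ N * J₀ := by
      rw [← hid]
      refine Finset.sum_congr rfl fun s _ => ?_
      simp only [hFu, hR, Circle.coe_pow]
    -- norms
    have hnorm : ((N + 1 : ℕ) : ℝ) * (‖c i₀‖ ^ N * ‖J₀‖) ≤
        ∑ s ∈ Finset.range (N + 1), ‖Fu (R s c)‖ := by
      have h1 : ‖(N + 1 : ℂ) * conj (c i₀) ^ N * J₀‖ = ((N + 1 : ℕ) : ℝ) * (‖c i₀‖ ^ N * ‖J₀‖) := by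
        rw [norm_mul, norm_mul, norm_pow, Complex.norm_conj]
        push_cast
        rw [show ‖(N + 1 : ℂ)‖ = (N + 1 : ℝ) by
          rw [show (N + 1 : ℂ) = ((N + 1 : ℕ) : ℂ) by push_cast; ring, Complex.norm_natCast]; push_cast; ring]
        ring
      rw [← h1, ← hid']
      refine (norm_sum_le _ _).trans (le_of_eq (Finset.sum_congr rfl fun s _ => ?_))
      rw [norm_mul, norm_pow, Circle.norm_coe, one_pow, one_mul]
    have hsq : (((N + 1 : ℕ) : ℝ) * (‖c i₀‖ ^ N * ‖J₀‖)) ^ 2 ≤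
        ((N + 1 : ℕ) : ℝ) * ∑ s ∈ Finset.range (N + 1), ‖Fu (R s c)‖ ^ 2 := by
      calc (((N + 1 : ℕ) : ℝ) * (‖c i₀‖ ^ N * ‖J₀‖)) ^ 2
          ≤ (∑ s ∈ Finset.range (N + 1), ‖Fu (R s c)‖) ^ 2 :=
            pow_le_pow_left₀ (by positivity) hnorm 2
        _ ≤ (Finset.range (N + 1)).card * ∑ s ∈ Finset.range (N + 1), ‖Fu (R s c)‖ ^ 2 :=
            sq_sum_le_card_mul_sum_sq
        _ = _ := by rw [Finset.card_range]
    have hreal : ((N + 1 : ℕ) : ℝ) * (‖J₀‖ ^ 2 * ‖c i₀‖ ^ (2 * N)) ≤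
        ∑ s ∈ Finset.range (N + 1), ‖Fu (R s c)‖ ^ 2 := by
      have hN : (0 : ℝ) < ((N + 1 : ℕ) : ℝ) := by positivity
      rw [← mul_le_mul_iff_right₀ hN]
      calc ((N + 1 : ℕ) : ℝ) * (((N + 1 : ℕ) : ℝ) * (‖J₀‖ ^ 2 * ‖c i₀‖ ^ (2 * N)))
          = (((N + 1 : ℕ) : ℝ) * (‖c i₀‖ ^ N * ‖J₀‖)) ^ 2 := by ring
        _ ≤ _ := hsq
    -- to `ℝ≥0∞`
    have h2 : ((N + 1 : ℕ) : ℝ≥0∞) * (((‖J₀‖₊ : ℝ≥0∞) ^ 2) * (‖c i₀‖₊ : ℝ≥0∞) ^ (2 * N)) =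
        ENNReal.ofReal (((N + 1 : ℕ) : ℝ) * (‖J₀‖ ^ 2 * ‖c i₀‖ ^ (2 * N))) := by
      rw [ENNReal.ofReal_mul (by positivity), ENNReal.ofReal_natCast,
        ENNReal.ofReal_mul (by positivity), ENNReal.ofReal_pow (norm_nonneg _),
        ENNReal.ofReal_pow (norm_nonneg _), ofReal_norm, ofReal_norm]
      rfl
    have h3 : ∑ s ∈ Finset.range (N + 1), ((‖Fu (R s c)‖₊ : ℝ≥0∞) ^ 2) =
        ENNReal.ofReal (∑ s ∈ Finset.range (N + 1), ‖Fu (R s c)‖ ^ 2) := by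
      rw [ENNReal.ofReal_sum_of_nonneg fun s _ => by positivity]
      refine Finset.sum_congr rfl fun s _ => ?_
      rw [ENNReal.ofReal_pow (norm_nonneg _), ofReal_norm]
      rfl
    rw [h2, h3]
    exact ENNReal.ofReal_le_ofReal hreal
  -- measurability of the integrand
  have hmeas : Measurable fun c : ι → ℂ => w c * ((‖Fu c‖₊ : ℝ≥0∞) ^ 2) :=
    measurable_weight_mul_form m hΨ
  -- each rotated integral equals the unrotated one
  have heach : ∀ s : ℕ, ∫⁻ c, w c * ((‖Fu (R s c)‖₊ : ℝ≥0∞) ^ 2) = ∫⁻ c, w c * ((‖Fu c‖₊ : ℝ≥0∞) ^ 2) := by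
    intro s
    have hwR : ∀ c, w c = w (R s c) := by
      intro c
      simp only [hw, hR]
      rw [nsq_rotate_coord i₀ (ωc ^ s) c]
    calc ∫⁻ c, w c * ((‖Fu (R s c)‖₊ : ℝ≥0∞) ^ 2)
        = ∫⁻ c, (fun c => w c * ((‖Fu c‖₊ : ℝ≥0∞) ^ 2)) (R s c) :=
          lintegral_congr fun c => by rw [hwR c]
      _ = ∫⁻ c, w c * ((‖Fu c‖₊ : ℝ≥0∞) ^ 2) :=
          (measurePreserving_rotate_coord i₀ (ωc ^ s)).lintegral_comp hmeas
  -- integrate the pointwise bound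
  have hRmeas : ∀ s : ℕ, Measurable (R s) := by
    intro s
    refine measurable_pi_lambda _ fun i => ?_
    by_cases hi : i = i₀
    · simp only [hR, hi, if_true]; exact (measurable_pi_apply i₀).const_mul _
    · simp only [hR, hi, if_false]; exact measurable_pi_apply i
  have hint : ((N + 1 : ℕ) : ℝ≥0∞) * (((‖J₀‖₊ : ℝ≥0∞) ^ 2) *
      ∫⁻ c, w c * (‖c i₀‖₊ : ℝ≥0∞) ^ (2 * N)) ≤
      ((N + 1 : ℕ) : ℝ≥0∞) * ∫⁻ c, w c * ((‖Fu c‖₊ : ℝ≥0∞) ^ 2) := by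
    have hm1 : Measurable fun c : ι → ℂ => w c * (‖c i₀‖₊ : ℝ≥0∞) ^ (2 * N) :=
      (ENNReal.measurable_ofReal.comp (Real.measurable_exp.comp measurable_nsq.neg)).mul
        ((measurable_pi_apply i₀).nnnorm.coe_nnreal_ennreal.pow_const _)
    calc ((N + 1 : ℕ) : ℝ≥0∞) * (((‖J₀‖₊ : ℝ≥0∞) ^ 2) * ∫⁻ c, w c * (‖c i₀‖₊ : ℝ≥0∞) ^ (2 * N))
        = ∫⁻ c, w c * (((N + 1 : ℕ) : ℝ≥0∞) * (((‖J₀‖₊ : ℝ≥0∞) ^ 2) * (‖c i₀‖₊ : ℝ≥0∞) ^ (2 * N))) := by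
          rw [← lintegral_const_mul _ hm1, ← lintegral_const_mul _ (hm1.const_mul _)]
          refine lintegral_congr fun c => ?_
          ring
      _ ≤ ∫⁻ c, ∑ s ∈ Finset.range (N + 1), w c * ((‖Fu (R s c)‖₊ : ℝ≥0∞) ^ 2) := by
          refine lintegral_mono fun c => ?_
          rw [← Finset.mul_sum]
          exact mul_le_mul_right (hpt c) _
      _ = ∑ s ∈ Finset.range (N + 1), ∫⁻ c, w c * ((‖Fu (R s c)‖₊ : ℝ≥0∞) ^ 2) := by
          refine lintegral_finsetSum' _ fun s _ => ?_
          exact (hmeas.comp (hRmeas s)).aemeasurable.congr (Filter.Eventually.of_forall fun c => by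
            simp only [Function.comp_apply, hw, hR, nsq_rotate_coord i₀ (ωc ^ s) c])
      _ = ((N + 1 : ℕ) : ℝ≥0∞) * ∫⁻ c, w c * ((‖Fu c‖₊ : ℝ≥0∞) ^ 2) := by
          simp_rw [heach]
          rw [Finset.sum_const, Finset.card_range, nsmul_eq_mul]
  have hN0 : ((N + 1 : ℕ) : ℝ≥0∞) ≠ 0 := by exact_mod_cast Nat.succ_ne_zero N
  exact (ENNReal.mul_le_mul_iff_right hN0 (ENNReal.natCast_ne_top _)).1 hint


end HusimiConcentration

end Summit.AtomisticToContinuum.BoseEinsteinCondensation.Theorems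

end
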